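import Mathlib
import Literature.Barriers.CriticalPhenomena.IsingTrivialityFromDimensionFourProofs
import Literature.Probability.LatticeModels.CriticalCorrWellDefined
import Literature.Probability.LatticeModels.CriticalTwoPointBounds
import Literature.Probability.LatticeModels.FreeBoundaryReflectionPositivity
import Literature.Probability.LatticeModels.IsingAutomorphismCovariance
import Literature.Probability.LatticeModels.IsingFKG
import Literature.Probability.LatticeModels.CriticalGibbsUniqueness
import Summits.CriticalPhenomena.Ising3DConformalLimit.Theorems.HyperoctahedralRPInversionUpgradeNormalisedLatticeRP
import HarnessLib

/-!
# Route MarkovRigidity, support item `FieldRealisation` (stmt-CriticalPhenomena-11245):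
# the critical Gibbs measure on `ℤ³` — local limits, reflection positivity, mirror invariance, FKG

Helper towards clause (b) of `FieldRealisation`.  The approximating laws are smeared under a
probability measure `ν` on `{±1}^{ℤ³}` which is a DLR state at `(β_c, 0)` carrying the plus
correlations (`exists_plusMeasure_holds`).  This file records the structural properties of `ν` that
pass to the scaling limit in the later files:

* `tendsto_isingExpect_free_spinFun` — finite-volume free expectations of LOCAL observables
  converge to `∫ · dν` (Walsh expansion into spin products, `m*(β_c) = 0`);
* `integral_mirror_mul_self_nonneg` — REFLECTION POSITIVITY of `ν` through the site plane
  `{x₀ = 0}` for local observables of the closed half `{x₀ ≥ 0}` (finite volume: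
  `isingExpect_free_reflect_mul_self_nonneg`, FILS 1978, then the local limit);
* `map_mirror_eq` / `integral_comp_mirror` — MIRROR INVARIANCE of `ν` (the DLR class is stable
  under graph automorphisms, `IsGibbsMeasure.map_configRelabel`, and is a singleton at `β_c`,
  `hasUniqueGibbsMeasure_criticalBeta_holds`);
* `integral_mul_integral_le_integral_mul_of_monotone` — the FKG inequality for `ν` on local
  monotone observables (finite volume: `ising_fkg_holds`, then the local limit).

References: Fröhlich–Israel–Lieb–Simon 1978 §2–3; Fortuin–Kasteleyn–Ginibre 1971;
Friedli–Velenik 2017 Thm. 3.17, 3.21, 6.26; Georgii–Higuchi 2000 §2.  No definitions.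
-/

noncomputable section

namespace Summit.CriticalPhenomena.Ising3DConformalLimit.MarkovRigidityFieldRealisation

open MeasureTheory Filter Literature.Probability.LatticeModels Literature.Barriers.CriticalPhenomena
open Summit.CriticalPhenomena.Ising3DConformalLimit.Cruxes.InversionUpgradeNormalised.FreeEndpointGaussianClosure
open scoped Topology

variable {ν : Measure (SpinConfig (Site 3))}

/-! ### Local observables: free box limits -/

/-- **Free box limits of local observables at `β_c`.**  If `ν` carries the critical plus
correlations, then for every function `Φ` of the spin field depending only on the spins in a finite
`D`, `⟨Φ⟩^∅_{B(L);β_c,0} → ∫ Φ dν` (Walsh expansion into spin products; the free box correlations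
converge to the plus correlations since `m*(β_c) = 0`).
[cite: FriedliVelenik2017, Thm. 3.17, Lemma 3.23 and Thm. 3.28] -/
theorem tendsto_isingExpect_free_spinFun [IsFiniteMeasure ν]
    (hν : ∀ A : Finset (Site 3), spinCorr ν A = plusCorr 3 (criticalBeta 3) 0 A)
    (D : Finset (Site 3)) (Φ : (Site 3 → ℝ) → ℝ)
    (hΦ : ∀ s t : Site 3 → ℝ, (∀ x ∈ D, s x = t x) → Φ s = Φ t) :
    Tendsto (fun L : ℕ => isingExpect (zdGraph 3) (box 3 L) (criticalBeta 3) 0 .free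
      (fun σ => Φ (fun x => spinAt x σ))) atTop
      (𝓝 (∫ σ, Φ (fun x => spinAt x σ) ∂ν)) := by
  classical
  obtain ⟨c, hc⟩ := exists_localObs_eq_sum_spinProduct D
    (fun η => Φ (fun x => if hx : x ∈ D then ((η ⟨x, hx⟩ : ℤ) : ℝ) else 1))
  have hloc : (fun σ : SpinConfig (Site 3) => Φ (fun x => spinAt x σ)) = fun σ =>
      ∑ B : Finset ↥D, c B * spinProduct (B.map (Function.Embedding.subtype (· ∈ D))) σ := by
    funext σ
    rw [← hc σ]
    exact hΦ _ _ fun x hx => by simp [hx, spinAt]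
  rw [hloc, integral_sum_spinProduct]
  simp_rw [hν, isingExpect_sum_spinProduct]
  have hm : spontaneousMagnetization 3 (criticalBeta 3) = 0 :=
    spontaneousMagnetization_criticalBeta_eq_zero_holds (d := 3) le_rfl
  exact tendsto_finsetSum _ fun B _ =>
    (hasBoxLimit_isingCorr_of_spontaneousMagnetization_eq_zero (criticalBeta_nonneg 3) hm _
      .free (by simp)).const_mul _

/-- **Plus box limits of local observables at `β_c`** converge to `∫ · dν` as well
(`tendsto_isingExpect_plus_spinFun` and `plusExpect_spinFun_eq_integral`).
[cite: FriedliVelenik2017, Thm. 3.17 and Thm. 6.26] -/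
theorem tendsto_isingExpect_plus_spinFun' [IsFiniteMeasure ν]
    (hν : ∀ A : Finset (Site 3), spinCorr ν A = plusCorr 3 (criticalBeta 3) 0 A)
    (D : Finset (Site 3)) (Φ : (Site 3 → ℝ) → ℝ)
    (hΦ : ∀ s t : Site 3 → ℝ, (∀ x ∈ D, s x = t x) → Φ s = Φ t) :
    Tendsto (fun L : ℕ => isingExpect (zdGraph 3) (box 3 L) (criticalBeta 3) 0 .plus
      (fun σ => Φ (fun x => spinAt x σ))) atTop
      (𝓝 (∫ σ, Φ (fun x => spinAt x σ) ∂ν)) := by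
  rw [← plusExpect_spinFun_eq_integral (criticalBeta_nonneg 3) le_rfl hν D Φ hΦ]
  exact tendsto_isingExpect_plus_spinFun (criticalBeta_nonneg 3) le_rfl D Φ hΦ

/-! ### Reflection positivity through the site plane `{x₀ = 0}` -/

/-- **Reflection positivity of the critical measure** (site mirror `θ₀ : x ↦ (−x₀, x₁, x₂)`): for a
bounded measurable local observable `Φ` of the spins in a finite `D ⊂ {x₀ ≥ 0}`,
`0 ≤ ∫ Φ(σ ∘ θ₀) Φ(σ) dν`. [cite: FrohlichEtAl1978, §3 Thm 3.1] -/
theorem integral_mirror_mul_self_nonneg [IsFiniteMeasure ν]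
    (hν : ∀ A : Finset (Site 3), spinCorr ν A = plusCorr 3 (criticalBeta 3) 0 A)
    (D : Finset (Site 3)) (hD : ∀ x ∈ D, 0 ≤ x 0) (Φ : (Site 3 → ℝ) → ℝ)
    (hΦ : ∀ s t : Site 3 → ℝ, (∀ x ∈ D, s x = t x) → Φ s = Φ t)
    (hΦm : Measurable fun σ : SpinConfig (Site 3) => Φ (fun x => spinAt x σ))
    (hΦb : ∃ C, ∀ σ : SpinConfig (Site 3), |Φ (fun x => spinAt x σ)| ≤ C) :
    0 ≤ ∫ σ, Φ (fun x => spinAt (Function.update x 0 (-x 0)) σ) * Φ (fun x => spinAt x σ) ∂ν := by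
  classical
  set θ : Site 3 ≃ Site 3 := Function.Involutive.toPerm _ (mirror_involutive (0 : Fin 3)) with hθ
  have hθapp : ∀ x : Site 3, θ x = Function.update x 0 (-x 0) := fun x => rfl
  -- the product observable is local on `D ∪ θ D`
  set Ψ : (Site 3 → ℝ) → ℝ := fun s => Φ (fun x => s (θ x)) * Φ s with hΨ
  have hΨloc : ∀ s t : Site 3 → ℝ, (∀ x ∈ D ∪ D.image θ, s x = t x) → Ψ s = Ψ t := by
    intro s t hst
    simp only [hΨ]
    rw [hΦ (fun x => s (θ x)) (fun x => t (θ x)) fun x hx =>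
        hst _ (Finset.mem_union_right _ (Finset.mem_image_of_mem θ hx)),
      hΦ s t fun x hx => hst _ (Finset.mem_union_left _ hx)]
  have hlim := tendsto_isingExpect_free_spinFun hν (D ∪ D.image θ) Ψ hΨloc
  have hΨeq : (fun σ : SpinConfig (Site 3) => Ψ (fun x => spinAt x σ)) = fun σ =>
      Φ (fun x => spinAt (Function.update x 0 (-x 0)) σ) * Φ (fun x => spinAt x σ) := by
    funext σ; simp only [hΨ, hθapp]
  rw [hΨeq] at hlim
  refine ge_of_tendsto' hlim fun L => ?_
  -- finite-volume reflection positivity (free boundary condition, symmetric box)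
  have key := isingExpect_free_reflect_mul_self_nonneg (zdGraph 3) θ (mirror_involutive 0)
    (fun x y hxy => mirror_adj 0 hxy) (Λ := box 3 L) (fun x => mem_box_iff_mirror_mem_box 0 L x)
    (P := {x : Site 3 | 0 ≤ x 0}) (fun x => ?_) (fun x hx hθx => ?_) (fun x y hxy => ?_)
    (criticalBeta 3) 0 (F := fun σ => Φ (fun x => spinAt x σ)) hΦm ?_ hΦb
  · have heq : (fun σ : SpinConfig (Site 3) => Φ (fun x => spinAt (Function.update x 0 (-x 0)) σ) *
        Φ (fun x => spinAt x σ)) =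
        fun τ => Φ (fun x => spinAt x (configReflect θ τ)) * Φ (fun x => spinAt x τ) := by
      funext τ; rfl
    rw [heq]; exact key
  · simp only [Set.mem_setOf_eq, hθapp, Function.update_self]; omega
  · simp only [Set.mem_setOf_eq, hθapp, Function.update_self] at hx hθx
    rw [hθapp]
    have h0 : x 0 = 0 := by omega
    funext j
    by_cases hj : j = 0
    · subst hj; simp [h0]
    · simp [Function.update_of_ne hj]
  · simp only [Set.mem_setOf_eq, hθapp, Function.update_self]
    have h := apply_le_add_one_of_adj 0 hxy
    omega
  · intro σ τ hστ
    refine hΦ _ _ fun x hx => ?_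
    simp only [spinAt]
    rw [hστ x (hD x hx)]

/-! ### Mirror invariance -/

/-- The site mirror `θ₀` as an automorphism of the nearest-neighbour graph of `ℤ³`.
[cite: GeorgiiHiguchi2000, §2 p. 3] -/
theorem exists_mirror_iso :
    ∃ φ : zdGraph 3 ≃g zdGraph 3, ∀ x : Site 3, φ x = Function.update x 0 (-x 0) ∧
      φ.symm x = Function.update x 0 (-x 0) := by
  set θ : Site 3 ≃ Site 3 := Function.Involutive.toPerm _ (mirror_involutive (0 : Fin 3)) with hθ
  refine ⟨{ toEquiv := θ, map_rel_iff' := fun {x y} => ⟨fun h => ?_, fun h => mirror_adj 0 h⟩ },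
    fun x => ⟨rfl, ?_⟩⟩
  · have h' := mirror_adj 0 h
    rwa [show Function.update (θ x) 0 (-(θ x) 0) = x from mirror_involutive 0 x,
      show Function.update (θ y) 0 (-(θ y) 0) = y from mirror_involutive 0 y] at h'
  · change θ.symm x = _
    rw [Equiv.symm_apply_eq]
    exact (mirror_involutive 0 x).symm

/-- **Mirror invariance of the critical measure**: a DLR state at `(β_c, 0)` on `ℤ³` is invariant
under the site mirror `σ ↦ σ ∘ θ₀` — its image is again a DLR state (graph automorphisms preserve
the Ising specification) and `𝒢(β_c, 0)` is a singleton. [cite: GeorgiiHiguchi2000, §2 p. 3] -/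
theorem map_mirror_eq (hνG : ν ∈ isingGibbsMeasures 3 (criticalBeta 3) 0) :
    ν.map (fun σ : SpinConfig (Site 3) => fun x => σ (Function.update x 0 (-x 0))) = ν := by
  obtain ⟨φ, hφ⟩ := exists_mirror_iso
  have hmap := IsGibbsMeasure.map_configRelabel (zdGraph 3) φ
    ((mem_isingGibbsMeasures_iff 3 _ 0 ν).1 hνG)
  have hR : (configRelabel φ.toEquiv : SpinConfig (Site 3) → SpinConfig (Site 3)) =
      fun σ => fun x => σ (Function.update x 0 (-x 0)) := by
    funext σ x
    rw [configRelabel_apply]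
    exact congrArg σ (hφ x).2
  rw [hR] at hmap
  have huniq := (hasUniqueGibbsMeasure_criticalBeta_holds (d := 3) le_rfl).1
  exact huniq hmap hνG

/-- The site mirror on configurations is measurable. [folklore] -/
theorem measurable_mirrorConfig :
    Measurable fun σ : SpinConfig (Site 3) => fun x => σ (Function.update x 0 (-x 0)) :=
  measurable_pi_lambda _ fun _ => measurable_pi_apply _

/-- **Integrals are mirror invariant**: `∫ F(σ ∘ θ₀) dν = ∫ F dν` for a DLR state at `(β_c,0)`.
[cite: GeorgiiHiguchi2000, §2 p. 3] -/
theorem integral_comp_mirror (hνG : ν ∈ isingGibbsMeasures 3 (criticalBeta 3) 0)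
    {F : SpinConfig (Site 3) → ℝ} (hF : Measurable F) :
    ∫ σ, F (fun x => σ (Function.update x 0 (-x 0))) ∂ν = ∫ σ, F σ ∂ν := by
  have h := integral_map (μ := ν) measurable_mirrorConfig.aemeasurable hF.aestronglyMeasurable
    (f := F)
  rw [map_mirror_eq hνG] at h
  exact h.symm

/-! ### FKG for the critical measure -/

/-- **FKG inequality for the critical measure on local observables**: for bounded measurable
nondecreasing local observables `f, g`, `∫ f dν · ∫ g dν ≤ ∫ f g dν` (finite-volume FKG,
`ising_fkg_holds`, passed to the local limit). [cite: FriedliVelenik2017, Thm. 3.21] -/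
theorem integral_mul_integral_le_integral_mul_of_monotone [IsFiniteMeasure ν]
    (hν : ∀ A : Finset (Site 3), spinCorr ν A = plusCorr 3 (criticalBeta 3) 0 A)
    (D : Finset (Site 3)) (Φ Ψ : (Site 3 → ℝ) → ℝ)
    (hΦ : ∀ s t : Site 3 → ℝ, (∀ x ∈ D, s x = t x) → Φ s = Φ t)
    (hΨ : ∀ s t : Site 3 → ℝ, (∀ x ∈ D, s x = t x) → Ψ s = Ψ t)
    (hΦmono : Monotone fun σ : SpinConfig (Site 3) => Φ (fun x => spinAt x σ))
    (hΨmono : Monotone fun σ : SpinConfig (Site 3) => Ψ (fun x => spinAt x σ))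
    (hΦm : Measurable fun σ : SpinConfig (Site 3) => Φ (fun x => spinAt x σ))
    (hΨm : Measurable fun σ : SpinConfig (Site 3) => Ψ (fun x => spinAt x σ)) :
    (∫ σ, Φ (fun x => spinAt x σ) ∂ν) * (∫ σ, Ψ (fun x => spinAt x σ) ∂ν) ≤
      ∫ σ, Φ (fun x => spinAt x σ) * Ψ (fun x => spinAt x σ) ∂ν := by
  have h1 := tendsto_isingExpect_plus_spinFun' hν D Φ hΦ
  have h2 := tendsto_isingExpect_plus_spinFun' hν D Ψ hΨ
  have h12 := tendsto_isingExpect_plus_spinFun' hν D (fun s => Φ s * Ψ s) fun s t hst => by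
    rw [hΦ s t hst, hΨ s t hst]
  refine le_of_tendsto_of_tendsto' (h1.mul h2) h12 fun L => ?_
  exact ising_fkg_holds (zdGraph 3) (criticalBeta_nonneg 3) (box 3 L) 0 .plus _ _ hΦmono hΨmono
    hΦm hΨm

end Summit.CriticalPhenomena.Ising3DConformalLimit.MarkovRigidityFieldRealisation

end
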